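import Literature.Geometry.Symplectic.OrigamiSphereBlowDown
import Literature.Geometry.Kaehler.ProjectiveLineSymplectic
import HarnessLib

/-!
# Unfolding the origami 4-sphere, II: the fold data of `S⁴` (hemispheres, Hopf kernel)

Topic `Literature/Geometry/Symplectic`; sequel of `OrigamiSphereBlowDown.lean` (the blow-down map
`β = unfoldMap : S⁴ → ℂℙ²`, `(z₁, z₂, h) ↦ [z₁ : z₂ : h]`, its smoothness, the kernel criterion for
`dβ`, the hemispheres `upperHemisphere`, `lowerHemisphere`) and of
`Literature/Geometry/Kaehler/ProjectiveLineSymplectic.lean` (the tree's line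
`ComplexProjectiveSpace.lineIncl : ℂℙ¹ ↪ ℂℙ²`, `[v₀ : v₁] ↦ [v₀ : v₁ : 0]`, a smooth embedding and a
symplectic submanifold for the Fubini–Study form `CPn.fsForm 2`).
A. Cannas da Silva, V. Guillemin, A. R. Pires, *Symplectic Origami*, IMRN 2011 = arXiv:0909.4065,
Example 2.3 / **Example 2.6** / Prop. 2.8: the round `S⁴ ⊂ ℂ² × ℝ` is a symplectic FOLD along the equator `Z = {h = 0} ≅ S³`; the two sides
`V₊ = {h > 0}`, `V₋ = {h < 0}` collapse by `β` onto `ℂℙ²`, diffeomorphically from each open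
hemisphere onto the complement of the line `ℓ = {Z₂ = 0} ≅ ℂℙ¹`, with `β|_Z : S³ → ℓ` the Hopf map
and `ker dβ` the Hopf direction along `Z`. This file proves these clauses (the typed fold data of the
route `SmoothPoincare4/SymplecticOrigami` at `M = S⁴`): `β x ∈ ℓ` iff `h(x) = 0`
(`unfoldMap_mem_range_lineIncl_iff`); `β` is injective on each open hemisphere with image
`(range lineIncl)ᶜ` (`injOn_unfoldMap_upper/lower`, `unfoldMap_image_upper/lower`) and maps the
frontiers into the line; `dβ_x` is bijective for `h ≠ 0` (`bijective_mfderiv_unfoldMap`) and has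
ONE-dimensional kernel, spanned by the Hopf vector `J x = rotFive x`, for `h = 0`
(`finrank_ker_mfderiv_unfoldMap`); everything is packaged per side in `hemisphere_foldData`.

## References

* [CannasdasilvaGuilleminPires2010] A. Cannas da Silva, V. Guillemin, A. R. Pires, *Symplectic
  Origami*, IMRN 2011 (18) 4252–4293 = arXiv:0909.4065, Example 2.3, Example 2.6, Prop. 2.8.
-/

noncomputable section

open scoped Manifold ContDiff Topology LinearAlgebra.Projectivization InnerProductSpace
open Set Function Module Projectivization
open Literature.NumberTheory.Transcendental Literature.AlgebraicGeometry.Motives.FubiniStudy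
open Literature.Geometry.Kaehler Literature.Topology.FourManifolds
open Literature.Topology.FourManifolds.ComplexProjectiveSpace

namespace Literature.Geometry.Symplectic

/-- Local notation: `𝔼 n` is the model space `EuclideanSpace ℝ (Fin n)`. -/
local notation "𝔼" n:arg => EuclideanSpace ℝ (Fin n)

/-- Local notation: `𝕊⁴` is the unit sphere in `EuclideanSpace ℝ (Fin 5)`. -/
local notation "𝕊⁴" => (Metric.sphere (0 : EuclideanSpace ℝ (Fin 5)) 1)

attribute [local instance] fact_finrank_euclideanSpace_five

/-! ### The equator goes to the line `ℂℙ¹ = {Z₂ = 0} ⊂ ℂℙ²` -/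

/-- `β x ∈ ℓ ↔ h(x) = 0`: the blow-down map sends exactly the equator to the tree's line
`ComplexProjectiveSpace.lineIncl` (`= {Z₂ = 0}`, `CPn.range_lineIncl`). [folklore] -/
theorem unfoldMap_mem_range_lineIncl_iff (x : 𝕊⁴) :
    unfoldMap x ∈ range lineIncl ↔ (x : 𝔼 5) 4 = 0 := by
  rw [CPn.range_lineIncl, mem_setOf_eq, unfoldMap_eq_mk, coordNeZero_mk, not_not]
  show cplxCoord (x : 𝔼 5) 2 = 0 ↔ _
  rw [cplxCoord_apply_two, Complex.ofReal_eq_zero]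

/-! ### Tangent vectors of `S⁴ ⊂ ℝ⁵` -/

/-- `⟪x, dι v⟫ = 0` (the range of `dι` is `x^⊥`, Mathlib's `range_mfderiv_coe_sphere`). [folklore] -/
theorem inner_mfderiv_val_sphereFour (x : 𝕊⁴) (v : TangentSpace (𝓡 4) x) :
    ⟪(x : 𝔼 5), (mfderiv (𝓡 4) 𝓘(ℝ, 𝔼 5) (Subtype.val : 𝕊⁴ → 𝔼 5) x v : 𝔼 5)⟫_ℝ = 0 := by
  have h : (mfderiv (𝓡 4) 𝓘(ℝ, 𝔼 5) (Subtype.val : 𝕊⁴ → 𝔼 5) x v : 𝔼 5) ∈ (ℝ ∙ (x : 𝔼 5))ᗮ := by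
    rw [← range_mfderiv_coe_sphere (E := 𝔼 5) (n := 4) x]
    exact ⟨v, rfl⟩
  exact (Submodule.mem_orthogonal_singleton_iff_inner_right).1 h

/-- Every vector orthogonal to `x` is `dι v` for some tangent vector `v`. [folklore] -/
theorem exists_mfderiv_val_sphereFour_eq (x : 𝕊⁴) {V : 𝔼 5} (hV : ⟪(x : 𝔼 5), V⟫_ℝ = 0) :
    ∃ v : TangentSpace (𝓡 4) x, (mfderiv (𝓡 4) 𝓘(ℝ, 𝔼 5) (Subtype.val : 𝕊⁴ → 𝔼 5) x v : 𝔼 5) = V := by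
  have h : V ∈ (ℝ ∙ (x : 𝔼 5))ᗮ := (Submodule.mem_orthogonal_singleton_iff_inner_right).2 hV
  rw [← range_mfderiv_coe_sphere (E := 𝔼 5) (n := 4) x] at h
  obtain ⟨v, hv⟩ := h
  exact ⟨v, hv⟩

/-! ### `dβ` off the equator is bijective -/

/-- **Off the equator `dβ_x` is injective**: a kernel vector has `cplxCoord (dι v) ∈ ℂ · cplxCoord x`,
hence (the `h`-coordinate being real and non-zero) `dι v ∈ ℝ x`; but `dι v ⟂ x`, so `dι v = 0` and
`v = 0`. [cite: CannasdasilvaGuilleminPires2010, Example 2.6] -/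
theorem injective_mfderiv_unfoldMap {x : 𝕊⁴} (hx : (x : 𝔼 5) 4 ≠ 0) :
    Injective (mfderiv (𝓡 4) (𝓡 4) unfoldMap x) := by
  refine (injective_iff_map_eq_zero _).2 fun v hv ↦ ?_
  obtain ⟨a, ha⟩ := (mfderiv_unfoldMap_eq_zero_iff x v).1 hv
  have hV := eq_smul_of_cplxCoord_eq_smul hx ha
  have hinner := inner_mfderiv_val_sphereFour x v
  rw [hV, inner_smul_right, real_inner_self_eq_norm_sq, norm_eq_of_mem_sphere x, one_pow,
    mul_one] at hinner
  have h0 : (mfderiv (𝓡 4) 𝓘(ℝ, 𝔼 5) (Subtype.val : 𝕊⁴ → 𝔼 5) x v : 𝔼 5) = 0 := by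
    rw [hV, hinner, zero_smul]
    rfl
  exact mfderiv_coe_sphere_injective (E := 𝔼 5) (n := 4) x (by rw [h0, map_zero])

/-- **Off the equator `dβ_x` is bijective** (injective endomorphism of `ℝ⁴`).
[cite: CannasdasilvaGuilleminPires2010, Prop. 2.8] -/
theorem bijective_mfderiv_unfoldMap {x : 𝕊⁴} (hx : (x : 𝔼 5) 4 ≠ 0) :
    Bijective (mfderiv (𝓡 4) (𝓡 4) unfoldMap x) := by
  have hinj := injective_mfderiv_unfoldMap hx
  set T : (𝔼 4) →ₗ[ℝ] (𝔼 4) := (mfderiv (𝓡 4) (𝓡 4) unfoldMap x).toLinearMap with hT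
  have hTinj : Injective T := hinj
  exact ⟨hinj, LinearMap.surjective_of_injective hTinj⟩

/-! ### `dβ` on the equator: the kernel is the Hopf line -/

/-- `⟪x, J x⟫ = 0` for the Hopf vector `J x = rotFive x`. [folklore] -/
theorem inner_rotFive_self (X : 𝔼 5) : ⟪X, rotFive X⟫_ℝ = 0 := by
  simp [rotFive, PiLp.inner_apply, Fin.sum_univ_five]
  ring

/-- `‖J x‖ = 1` on the equator. [folklore] -/
theorem rotFive_ne_zero {x : 𝕊⁴} (hx : (x : 𝔼 5) 4 = 0) : rotFive (x : 𝔼 5) ≠ 0 := by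
  intro h
  have h1 : ‖(x : 𝔼 5)‖ ^ 2 = 1 := by rw [norm_eq_of_mem_sphere x, one_pow]
  rw [EuclideanSpace.real_norm_sq_eq, Fin.sum_univ_five] at h1
  have e0 := congrArg (fun V : 𝔼 5 ↦ V 0) h
  have e1 := congrArg (fun V : 𝔼 5 ↦ V 1) h
  have e2 := congrArg (fun V : 𝔼 5 ↦ V 2) h
  have e3 := congrArg (fun V : 𝔼 5 ↦ V 3) h
  simp [rotFive] at e0 e1 e2 e3
  simp [e0, e1, e2, e3, hx] at h1

/-- **On the equator the kernel of `dβ_x` is the Hopf line**: there is a tangent vector `v₀ ≠ 0`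
with `dι v₀ = J x` such that `ker dβ_x = ℝ v₀`. Indeed `dβ_x(v) = 0` iff
`dι v = (re a) x + (im a) J x` for some `a ∈ ℂ` (`cplxCoord_eq_smul_iff`), and `dι v ⟂ x` kills
`re a`. (Cannas da Silva–Guillemin–Pires 2010, Example 2.3/2.6: the null foliation is the Hopf
foliation.) [cite: CannasdasilvaGuilleminPires2010, Example 2.6] -/
theorem ker_mfderiv_unfoldMap {x : 𝕊⁴} (hx : (x : 𝔼 5) 4 = 0) :
    ∃ v₀ : TangentSpace (𝓡 4) x, v₀ ≠ 0 ∧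
      (mfderiv (𝓡 4) 𝓘(ℝ, 𝔼 5) (Subtype.val : 𝕊⁴ → 𝔼 5) x v₀ : 𝔼 5) = rotFive (x : 𝔼 5) ∧
      LinearMap.ker (mfderiv (𝓡 4) (𝓡 4) unfoldMap x).toLinearMap = Submodule.span ℝ {v₀} := by
  obtain ⟨v₀, hv₀⟩ := exists_mfderiv_val_sphereFour_eq x (inner_rotFive_self (x : 𝔼 5))
  have hv₀ne : v₀ ≠ 0 := by
    intro h
    apply rotFive_ne_zero hx
    rw [← hv₀, h, map_zero]
    rfl
  refine ⟨v₀, hv₀ne, hv₀, ?_⟩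
  ext v
  rw [LinearMap.mem_ker, ContinuousLinearMap.coe_coe, mfderiv_unfoldMap_eq_zero_iff,
    Submodule.mem_span_singleton]
  constructor
  · rintro ⟨a, ha⟩
    have hV := (cplxCoord_eq_smul_iff hx).1 ha
    have hinner := inner_mfderiv_val_sphereFour x v
    rw [hV, inner_add_right, inner_smul_right, inner_smul_right, real_inner_self_eq_norm_sq,
      norm_eq_of_mem_sphere x, one_pow, mul_one, inner_rotFive_self, mul_zero, add_zero] at hinner
    refine ⟨a.im, mfderiv_coe_sphere_injective (E := 𝔼 5) (n := 4) x ?_⟩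
    rw [map_smul, hV, hinner, zero_smul, zero_add, hv₀]
    rfl
  · rintro ⟨t, rfl⟩
    refine ⟨(t : ℂ) * Complex.I, ?_⟩
    rw [cplxCoord_eq_smul_iff hx, map_smul, hv₀]
    simp
    rfl

/-- **On the equator `ker dβ_x` is one-dimensional** (the corank-1 clause of the fold data).
[cite: CannasdasilvaGuilleminPires2010, Example 2.6] -/
theorem finrank_ker_mfderiv_unfoldMap {x : 𝕊⁴} (hx : (x : 𝔼 5) 4 = 0) :
    finrank ℝ (LinearMap.ker (mfderiv (𝓡 4) (𝓡 4) unfoldMap x).toLinearMap) = 1 := by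
  obtain ⟨v₀, hv₀, -, hker⟩ := ker_mfderiv_unfoldMap hx
  rw [hker, finrank_span_singleton hv₀]

/-! ### Injectivity and images of `β` on the hemispheres -/

/-- `β(-x) = β(x)` (`[-w] = [w]`). [folklore] -/
theorem unfoldMap_neg (x : 𝕊⁴) : unfoldMap (-x) = unfoldMap x := by
  rw [unfoldMap_eq_mk, unfoldMap_eq_mk, ComplexProjectiveSpace.mk_eq_mk_iff]
  refine ⟨-1, ?_⟩
  show (-1 : ℂ) • cplxCoord (x : 𝔼 5) = cplxCoord ((-x : 𝕊⁴) : 𝔼 5)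
  rw [coe_neg_sphere, map_neg, neg_one_smul]

/-- **`β` separates antipodes only**: if `β x = β x'` and `h(x') ≠ 0` then `x = ± x'`. Indeed
`cplxCoord x = a • cplxCoord x'` forces `a` real (`eq_smul_of_cplxCoord_eq_smul`), and unit norms
force `a = ± 1`. [folklore] -/
theorem eq_or_eq_neg_of_unfoldMap_eq {x x' : 𝕊⁴} (h : unfoldMap x = unfoldMap x')
    (hx' : (x' : 𝔼 5) 4 ≠ 0) : x = x' ∨ x = -x' := by
  rw [unfoldMap_eq_mk, unfoldMap_eq_mk, ComplexProjectiveSpace.mk_eq_mk_iff] at h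
  obtain ⟨a, ha⟩ := h
  have hx : (x : 𝔼 5) = a.re • (x' : 𝔼 5) := eq_smul_of_cplxCoord_eq_smul hx' ha.symm
  have hnorm : |a.re| = 1 := by
    have := norm_eq_of_mem_sphere x
    rw [hx, norm_smul, norm_eq_of_mem_sphere x', mul_one, Real.norm_eq_abs] at this
    exact this
  rcases abs_eq (zero_le_one) |>.1 hnorm with h1 | h1
  · left
    apply Subtype.ext
    rw [hx, h1, one_smul]
  · right
    apply Subtype.ext
    rw [hx, h1, coe_neg_sphere, neg_one_smul]

/-- **`β` is injective on the open upper hemisphere.** [cite: CannasdasilvaGuilleminPires2010, Prop. 2.8] -/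
theorem injOn_unfoldMap_upper : InjOn unfoldMap (upperHemisphere : Set 𝕊⁴) := by
  intro x hx x' hx' h
  rw [coe_upperHemisphere, mem_setOf_eq] at hx hx'
  rcases eq_or_eq_neg_of_unfoldMap_eq h hx'.ne' with h1 | h1
  · exact h1
  · exfalso
    have : (x : 𝔼 5) 4 = -((x' : 𝔼 5) 4) := by
      rw [h1, coe_neg_sphere]
      rfl
    linarith

/-- **`β` is injective on the open lower hemisphere.** [cite: CannasdasilvaGuilleminPires2010, Prop. 2.8] -/
theorem injOn_unfoldMap_lower : InjOn unfoldMap (lowerHemisphere : Set 𝕊⁴) := by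
  intro x hx x' hx' h
  rw [coe_lowerHemisphere, mem_setOf_eq] at hx hx'
  rcases eq_or_eq_neg_of_unfoldMap_eq h hx'.ne with h1 | h1
  · exact h1
  · exfalso
    have : (x : 𝔼 5) 4 = -((x' : 𝔼 5) 4) := by
      rw [h1, coe_neg_sphere]
      rfl
    linarith

/-- **Every point off the line is `β` of a point of the upper hemisphere** (and of its antipode):
for `p = [v]` with `v₂ ≠ 0`, normalise `v₂ = 1`, read `w = cplxCoord y` with `y₄ = 1`, and take
`x = y / ‖y‖`. [cite: CannasdasilvaGuilleminPires2010, Prop. 2.8] -/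
theorem exists_unfoldMap_eq_of_not_mem {p : ComplexProjectivePlane} (hp : p ∉ range lineIncl) :
    ∃ x : 𝕊⁴, 0 < (x : 𝔼 5) 4 ∧ unfoldMap x = p := by
  rw [CPn.range_lineIncl, mem_setOf_eq, not_not] at hp
  induction p using ComplexProjectiveSpace.ind with
  | h wv =>
  have hv0 : wv.1 2 ≠ 0 := (coordNeZero_mk 2 wv).1 hp
  set v : Fin 3 → ℂ := wv.1 with hv
  set w : Fin 3 → ℂ := (v 2)⁻¹ • v with hw
  have hw0 : w 2 = 1 := by simp [hw, inv_mul_cancel₀ hv0]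
  set y : 𝔼 5 := WithLp.toLp 2 ![(w 0).re, (w 0).im, (w 1).re, (w 1).im, 1] with hy
  have hyw : cplxCoord y = w := by
    funext k
    fin_cases k
    · apply Complex.ext <;> simp [hy]
    · apply Complex.ext <;> simp [hy]
    · simp [hy, hw0]
  have hy4 : y 4 = 1 := by simp [hy]
  have hyne : y ≠ 0 := by
    intro h
    have := congrArg (fun V : 𝔼 5 ↦ V 4) h
    simp [hy4] at this
  have hnorm : 0 < ‖y‖ := norm_pos_iff.2 hyne
  set x : 𝕊⁴ := ⟨‖y‖⁻¹ • y, by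
    rw [mem_sphere_zero_iff_norm, norm_smul, norm_inv, norm_norm, inv_mul_cancel₀ hnorm.ne']⟩ with hx
  refine ⟨x, ?_, ?_⟩
  · show 0 < (‖y‖⁻¹ • y) 4
    rw [PiLp.smul_apply, hy4, smul_eq_mul, mul_one]
    exact inv_pos.2 hnorm
  · rw [unfoldMap_eq_mk, ComplexProjectiveSpace.mk_eq_mk_iff]
    refine ⟨((‖y‖⁻¹ : ℝ) : ℂ) * (v 2)⁻¹, ?_⟩
    show (((‖y‖⁻¹ : ℝ) : ℂ) * (v 2)⁻¹) • v = cplxCoord (‖y‖⁻¹ • y)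
    rw [map_smul, hyw, hw, ← Complex.coe_smul, smul_smul]

/-- **The image of the open upper hemisphere is the complement of the line.**
[cite: CannasdasilvaGuilleminPires2010, Prop. 2.8] -/
theorem unfoldMap_image_upper : unfoldMap '' (upperHemisphere : Set 𝕊⁴) = (range lineIncl)ᶜ := by
  ext p
  constructor
  · rintro ⟨x, hx, rfl⟩
    rw [coe_upperHemisphere, mem_setOf_eq] at hx
    rw [mem_compl_iff, unfoldMap_mem_range_lineIncl_iff]
    exact hx.ne'
  · intro hp
    obtain ⟨x, hx, hxp⟩ := exists_unfoldMap_eq_of_not_mem hp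
    exact ⟨x, hx, hxp⟩

/-- **The image of the open lower hemisphere is the complement of the line** (use the antipode,
`β(-x) = β(x)`). [cite: CannasdasilvaGuilleminPires2010, Prop. 2.8] -/
theorem unfoldMap_image_lower : unfoldMap '' (lowerHemisphere : Set 𝕊⁴) = (range lineIncl)ᶜ := by
  ext p
  constructor
  · rintro ⟨x, hx, rfl⟩
    rw [coe_lowerHemisphere, mem_setOf_eq] at hx
    rw [mem_compl_iff, unfoldMap_mem_range_lineIncl_iff]
    exact hx.ne
  · intro hp
    obtain ⟨x, hx, hxp⟩ := exists_unfoldMap_eq_of_not_mem hp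
    refine ⟨-x, ?_, by rw [unfoldMap_neg, hxp]⟩
    show ((-x : 𝕊⁴) : 𝔼 5) 4 < 0
    rw [coe_neg_sphere]
    show -((x : 𝔼 5) 4) < 0
    linarith

/-- `β` maps the frontier of `V₊` into the line. [folklore] -/
theorem unfoldMap_image_frontier_upper :
    unfoldMap '' frontier (upperHemisphere : Set 𝕊⁴) ⊆ range lineIncl := by
  rintro _ ⟨x, hx, rfl⟩
  exact (unfoldMap_mem_range_lineIncl_iff x).2 (frontier_upperHemisphere_subset hx)

/-- `β` maps the frontier of `V₋` into the line. [folklore] -/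
theorem unfoldMap_image_frontier_lower :
    unfoldMap '' frontier (lowerHemisphere : Set 𝕊⁴) ⊆ range lineIncl := by
  rintro _ ⟨x, hx, rfl⟩
  exact (unfoldMap_mem_range_lineIncl_iff x).2 (frontier_lowerHemisphere_subset hx)

/-! ### The fold data of one side, packaged -/

/-- **The fold data of one side of the origami sphere** (the per-side clauses of the route items
`OrigamiRung` / `OrigamiFoldExistence` at `M = S⁴`, for either hemisphere `W`): `β` is `C^∞` on an
open neighbourhood of `closure W` (all of `S⁴`), injective on `W` with image the complement of the
line, a local diffeomorphism on `W`, and collapses the frontier of `W` into the line with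
corank-one differential. [cite: CannasdasilvaGuilleminPires2010, Prop. 2.8] -/
theorem hemisphere_foldData (W : TopologicalSpace.Opens 𝕊⁴)
    (hW : W = upperHemisphere ∨ W = lowerHemisphere) :
    (∃ U : Set 𝕊⁴, IsOpen U ∧ closure (W : Set 𝕊⁴) ⊆ U ∧ ContMDiffOn (𝓡 4) (𝓡 4) ∞ unfoldMap U) ∧
    InjOn unfoldMap (W : Set 𝕊⁴) ∧
    unfoldMap '' (W : Set 𝕊⁴) = (range lineIncl)ᶜ ∧
    (∀ x ∈ (W : Set 𝕊⁴), Bijective (mfderiv (𝓡 4) (𝓡 4) unfoldMap x)) ∧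
    unfoldMap '' frontier (W : Set 𝕊⁴) ⊆ range lineIncl ∧
    (∀ x ∈ frontier (W : Set 𝕊⁴),
      finrank ℝ (LinearMap.ker (mfderiv (𝓡 4) (𝓡 4) unfoldMap x).toLinearMap) = 1) := by
  refine ⟨⟨univ, isOpen_univ, subset_univ _, contMDiff_unfoldMap.contMDiffOn⟩, ?_⟩
  rcases hW with rfl | rfl
  · refine ⟨injOn_unfoldMap_upper, unfoldMap_image_upper, fun x hx ↦ ?_,
      unfoldMap_image_frontier_upper, fun x hx ↦ ?_⟩
    · rw [coe_upperHemisphere, mem_setOf_eq] at hx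
      exact bijective_mfderiv_unfoldMap hx.ne'
    · exact finrank_ker_mfderiv_unfoldMap (frontier_upperHemisphere_subset hx)
  · refine ⟨injOn_unfoldMap_lower, unfoldMap_image_lower, fun x hx ↦ ?_,
      unfoldMap_image_frontier_lower, fun x hx ↦ ?_⟩
    · rw [coe_lowerHemisphere, mem_setOf_eq] at hx
      exact bijective_mfderiv_unfoldMap hx.ne
    · exact finrank_ker_mfderiv_unfoldMap (frontier_lowerHemisphere_subset hx)

end Literature.Geometry.Symplectic
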